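import Literature.Geometry.Lorentzian.SpacetimeLocalConvergenceTrans
import Literature.Geometry.Lorentzian.SpacetimePointPushDatum
import HarnessLib

/-!
# Base-point adjustment of pointed `Cᵏ_loc` limits of spacetimes
(topic `Geometry/Lorentzian`; `LocalSubconvergence.adjust` / `SubconvergesLocallyTo.adjust`:
Petersen 2006, Ch. 10, §3.2 — a pointed limit does not change when the base points are moved by
`o(1)`; Hale 1980, Ch. I §8 — limit sets)

If `(𝓢ₙ, qₙ)` subconverges to `(𝓤, u)` and `x m → u` is ANY sequence of points of the limit
converging to the base point, then along a further subsequence the spacetimes `𝓢ₙ` based at points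
of the form `Q m = φ_{n m}(x (j m))` — images, under comparison maps of the given convergence, of the
points `x (j m)` along a strictly increasing `j` — subconverge to `(𝓤, u)`
(`SubconvergesLocallyTo.adjust'`; for translates of one spacetime, `SubconvergesLocallyTo.adjust`:
suitable translates `(𝓢, Qₘ)` subconverge to `(𝓤, u)`). This is `LocalSubconvergence.trans` of the
given datum with the point-pushing datum `LocalSubconvergence.ofTendsto` of `(𝓤, x m) ⇀ (𝓤, u)`.

## References
* [Petersen2006] P. Petersen, *Riemannian Geometry*, 2nd ed., GTM 171, Springer 2006, Ch. 10, §3.2.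
* [Hale1980] J. K. Hale, *Ordinary Differential Equations*, 2nd ed., Krieger 1980, Ch. I §8.
-/

noncomputable section

open TopologicalSpace Manifold Filter Topology Set Function

universe u w

namespace Literature.Geometry.Lorentzian

namespace Spacetime

namespace LocalSubconvergence

variable {𝓢ₙ : ℕ → Spacetime.{u} 4} {q : ∀ n, (𝓢ₙ n).carrier} {𝓤 : Spacetime.{w} 4} {u : 𝓤.carrier}
  {k : ℕ}

/-- **Base-point adjustment (data).** From `D : (𝓢ₙ, qₙ) ⇀ (𝓤, u)` and a sequence `x m → u` in the
limit, the diagonal datum of `D` with the point-pushing datum of `x`: the spacetimes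
`𝓢_{sub (n m)}` based at the images of the points `x (j m)` converge to `(𝓤, u)`. [cite: Petersen2006, Ch. 10 §3.2] -/
def adjust (D : LocalSubconvergence 𝓢ₙ q 𝓤 u k) {x : ℕ → 𝓤.carrier}
    (hx : Tendsto x atTop (𝓝 u)) :
    LocalSubconvergence (fun m ↦ 𝓢ₙ (D.sub (index D (ofTendsto 𝓤 hx k) m)))
      (transBasepoint D (ofTendsto 𝓤 hx k)) 𝓤 u k :=
  trans D (ofTendsto 𝓤 hx k)

/-- The base points of the adjusted datum are images of the points `x (j m)`,
`j m = level (m+1) + shift`, under comparison maps of `D`. [folklore] -/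
theorem adjust_basepoint (D : LocalSubconvergence 𝓢ₙ q 𝓤 u k) {x : ℕ → 𝓤.carrier}
    (hx : Tendsto x atTop (𝓝 u)) (m : ℕ) :
    transBasepoint D (ofTendsto 𝓤 hx k) m =
      D.embed (index D (ofTendsto 𝓤 hx k) m)
        (x ((ofTendsto 𝓤 hx k).level (m + 1) + pushShift 𝓤 hx)) := by
  rw [transBasepoint_eq, (ofTendsto 𝓤 hx k).embed_basepoint]
  rfl

/-- The index `j m = level (m+1) + shift` of the adjusted base points is strictly increasing. [folklore] -/
theorem strictMono_adjustIndex {x : ℕ → 𝓤.carrier} (hx : Tendsto x atTop (𝓝 u)) (k : ℕ) :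
    StrictMono fun m ↦ (ofTendsto 𝓤 hx k).level (m + 1) + pushShift 𝓤 hx :=
  ((ofTendsto 𝓤 hx k).strictMono_level.comp (strictMono_id.add_const 1)).add_const _

end LocalSubconvergence

/-- **Base-point adjustment** (`Prop` level, general sequences): if `(𝓢ₙ, qₙ) ⇀ (𝓤, u)` and
`x m → u` in `𝓤`, then along a further subsequence `σ` the spacetimes `𝓢_{σ m}` based at points
`Q m = φ_{n m}(x (j m))` — images of the `x (j m)`, `j` strictly increasing, under comparison maps
`φ` of a datum of the given convergence — subconverge to `(𝓤, u)`. [cite: Petersen2006, Ch. 10 §3.2] -/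
theorem SubconvergesLocallyTo.adjust' {𝓢ₙ : ℕ → Spacetime.{u} 4} {q : ∀ n, (𝓢ₙ n).carrier}
    {𝓤 : Spacetime.{w} 4} {u : 𝓤.carrier} {k : ℕ} (h : SubconvergesLocallyTo 𝓢ₙ q 𝓤 u k)
    {x : ℕ → 𝓤.carrier} (hx : Tendsto x atTop (𝓝 u)) :
    ∃ (D : LocalSubconvergence 𝓢ₙ q 𝓤 u k) (n j : ℕ → ℕ), StrictMono (D.sub ∘ n) ∧ StrictMono j ∧
      SubconvergesLocallyTo (fun m ↦ 𝓢ₙ (D.sub (n m))) (fun m ↦ D.embed (n m) (x (j m))) 𝓤 u k := by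
  obtain ⟨D⟩ := h
  refine ⟨D, LocalSubconvergence.index D (LocalSubconvergence.ofTendsto 𝓤 hx k),
    fun m ↦ (LocalSubconvergence.ofTendsto 𝓤 hx k).level (m + 1) +
      LocalSubconvergence.pushShift 𝓤 hx,
    D.strictMono_sub.comp (LocalSubconvergence.strictMono_index D _),
    LocalSubconvergence.strictMono_adjustIndex hx k, ?_⟩
  have key : (fun m ↦ D.embed (LocalSubconvergence.index D (LocalSubconvergence.ofTendsto 𝓤 hx k) m)
      (x ((LocalSubconvergence.ofTendsto 𝓤 hx k).level (m + 1) +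
        LocalSubconvergence.pushShift 𝓤 hx))) =
      LocalSubconvergence.transBasepoint D (LocalSubconvergence.ofTendsto 𝓤 hx k) :=
    funext fun m ↦ (D.adjust_basepoint hx m).symm
  rw [key]
  exact ⟨D.adjust hx⟩

/-- **Base-point adjustment** (`Prop` level, translates of one spacetime): if `(𝓢, qₙ) ⇀ (𝓤, u)`
and `x m → u` in `𝓤`, then some translates `(𝓢, Qₘ)` subconverge to `(𝓤, u)` with
`Qₘ = φ_{n m}(x (j m))` for comparison maps `φ` of a datum of the given convergence, indices `n` and
a strictly increasing `j`. [cite: Petersen2006, Ch. 10 §3.2] -/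
theorem SubconvergesLocallyTo.adjust {𝓢 : Spacetime.{u} 4} {𝓤 : Spacetime.{w} 4}
    {q : ℕ → 𝓢.carrier} {u : 𝓤.carrier} {k : ℕ} (h : SubconvergesLocallyTo (fun _ ↦ 𝓢) q 𝓤 u k)
    {x : ℕ → 𝓤.carrier} (hx : Tendsto x atTop (𝓝 u)) :
    ∃ Q : ℕ → 𝓢.carrier, SubconvergesLocallyTo (fun _ ↦ 𝓢) Q 𝓤 u k ∧
      ∃ (D : LocalSubconvergence (fun _ ↦ 𝓢) q 𝓤 u k) (n j : ℕ → ℕ), StrictMono j ∧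
        ∀ m, Q m = D.embed (n m) (x (j m)) := by
  obtain ⟨D, n, j, -, hj, hconv⟩ := h.adjust' hx
  exact ⟨_, hconv, D, n, j, hj, fun _ ↦ rfl⟩

end Spacetime

end Literature.Geometry.Lorentzian
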